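import Literature.AlgebraicGeometry.Modules.LocalFrames
import HarnessLib

/-!
# The contraction `𝓗om(E, 𝓗om(E^∨, G)) → G` and the trace `𝓔nd(E) → 𝒪_X` of a finite locally
# free `𝒪_X`-module

Continuation of `Modules/LocalFrames.lean` (stage 3b of the series `SheafHom` / `SheafHomFunctor` /
`SheafHomExact` / `LocalFrames` built for `HodgeTheory/AtiyahClass.lean` and the real trace maps on
`Ext`). For a finite locally free `𝒪_X`-module `E` on a scheme `X`
(`Literature.AlgebraicGeometry.Motives.IsFiniteLocallyFree`) and any `𝒪_X`-module `G`:

* `trivNbhd hE x`, `TrivIndex hE x`, `trivFrame hE x : 𝒪^{I_x} ≅ E|_{U_x}` — a chosen frame at every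
  point; `piece hE U x = U ⊓ U_x` and `pieceFrame` — the induced framed cover of an open `U`;
* `contractValue hE G U B ∈ Γ(G, U)` — the **contraction value** of
  `B ∈ Γ(𝓗om(E, 𝓗om(E^∨, G)), U)`, GLUED (`existsUnique_contractValue`) from the local pieces
  `∑_i B(b_i)(λ_i)` (`frameContract`, `contractPieces`) — well defined by the frame independence and
  restriction compatibility of `frameContract` proved in `LocalFrames.lean`; on any framed open it IS
  `∑_i B(b_i)(λ_i)` (`map_contractValue`);
* `contract hE G : 𝓗om(E, 𝓗om(E^∨, G)) ⟶ G` — the **contraction** (evaluation) map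
  `E^∨ ⊗ E ⊗ G → G`, `λ ⊗ s ⊗ g ↦ λ(s) g`, read through `𝓗om(E, 𝓗om(E^∨, G)) ≅ E^∨ ⊗ E ⊗ G`
  (Hartshorne II Ex. 5.1 (b)), `contract_app_eq_frameContract`;
* `endToBidual : 𝓔nd(E) ⟶ 𝓗om(E, E^∨∨)` and `trace hE : 𝓔nd(E) = 𝓗om(E, E) ⟶ 𝒪_X` — the
  **trace** (biduality, Hartshorne II Ex. 5.1 (a), followed by the contraction); in a frame
  `tr(φ) = ∑_i λ_i(φ(b_i))` (`trace_app_eq_sum`), `tr(a · id) = rk(E) · a` (`trace_app_overScalar`),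
  `tr(id) = rk(E)` (`trace_app_id`).

These are the sheaf-level ingredients of the trace maps `Tr : Extⁱ(E, E ⊗ G) → Hⁱ(X, G)` of
Illusie / Buchweitz–Flenner ([BuchweitzFlenner2003] §4). Everything is proved; no named facts.

## References

* R. Hartshorne, *Algebraic Geometry*, GTM 52 (1977): II.5 (p. 109), II Ex. 5.1 (a), (b) (p. 123).
  [Hartshorne1977]
* R.-O. Buchweitz, H. Flenner, *A semiregularity map for modules and applications to deformations*,
  Compositio Math. 137 (2003), §4 (the trace map, sheaf level). [BuchweitzFlenner2003]
-/

noncomputable section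

open CategoryTheory AlgebraicGeometry Opposite TopologicalSpace Limits

namespace Literature.AlgebraicGeometry.Modules

open Literature.AlgebraicGeometry.Motives

universe u

variable {X : Scheme.{u}}

/-! ### Restricting frame contractions -/

section FrameRestrict

open scoped Classical

variable {E : X.Modules} (G : X.Modules) {U V W : X.Opens}

/-- Restricting `∑_i B(b_i)(λ_i)` computed in a frame `e` over `W ≤ U` to `Y ≤ W` gives the same
sum computed in ANY frame `e'` over `Y` (restriction compatibility and frame independence of
`frameContract`). [folklore] -/
lemma map_frameContract_restrictHom {I J : Type u} [Fintype I] [Fintype J] {Y : X.Opens}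
    (e : SheafOfModules.free I ≅ E.over W) (e' : SheafOfModules.free J ≅ E.over Y) (k : W ⟶ U)
    (l : Y ⟶ W) (B : E.over U ⟶ (sheafHom (dual E) G).over U) :
    G.presheaf.map l.op (frameContract G e (restrictHom k B)) =
      frameContract G e' (restrictHom (l ≫ k) B) := by
  rw [map_frameContract, ← restrictHom_comp']
  exact frameContract_eq G _ _ _

end FrameRestrict

/-! ### Chosen frames at points and the framed cover of an open -/

section Triv

open scoped Classical

variable {E : X.Modules} (hE : IsFiniteLocallyFree E)

/-- A trivialising open neighbourhood `U_x` of the point `x` (chosen from finite local freeness).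
[folklore] -/
def trivNbhd (x : X) : X.Opens :=
  (hE x).choose

/-- `x ∈ U_x`. [folklore] -/
lemma mem_trivNbhd (x : X) : x ∈ trivNbhd hE x :=
  (hE x).choose_spec.1

/-- The (finite) index type `I_x` of the chosen frame at `x`. [folklore] -/
def TrivIndex (x : X) : Type u :=
  (hE x).choose_spec.2.choose

/-- `I_x` is finite. [folklore] -/
instance finite_trivIndex (x : X) : Finite (TrivIndex hE x) :=
  (hE x).choose_spec.2.choose_spec.1

/-- `I_x` as a `Fintype`. [folklore] -/
instance fintypeTrivIndex (x : X) : Fintype (TrivIndex hE x) :=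
  Fintype.ofFinite _

/-- The chosen frame `𝒪^{I_x} ≅ E|_{U_x}` at `x`. [folklore] -/
def trivFrame (x : X) : SheafOfModules.free (TrivIndex hE x) ≅ E.over (trivNbhd hE x) :=
  (hE x).choose_spec.2.choose_spec.2.some

/-- The framed cover of an open `U`: `U ∩ U_x` for `x ∈ U`. [folklore] -/
abbrev piece (U : X.Opens) (x : U) : X.Opens :=
  U ⊓ trivNbhd hE x.1

/-- `U` is covered by the `U ∩ U_x`, `x ∈ U`. [folklore] -/
lemma le_iSup_piece {U : X.Opens} : U ≤ ⨆ x : U, piece hE U x :=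
  fun y hy => Opens.mem_iSup.2 ⟨⟨y, hy⟩, hy, mem_trivNbhd hE y⟩

/-- The frame on `U ∩ U_x` restricted from the chosen frame at `x`. [folklore] -/
def pieceFrame {U : X.Opens} (x : U) :
    SheafOfModules.free (TrivIndex hE x.1) ≅ E.over (piece hE U x) :=
  SheafOfModules.restrictTrivialisation (R := X.ringCatSheaf) (Opens.infLERight U (trivNbhd hE x.1))
    (trivFrame hE x.1)

end Triv

/-! ### Contraction values: gluing the local sums `∑_i B(b_i)(λ_i)` -/

section ContractValue

open scoped Classical

variable {E : X.Modules} (hE : IsFiniteLocallyFree E) (G : X.Modules) {U V W : X.Opens}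

/-- The local pieces `∑_i B(b_i)(λ_i) ∈ Γ(G, U ∩ U_x)` of the contraction value of
`B ∈ Γ(𝓗om(E, 𝓗om(E^∨, G)), U)`. [folklore] -/
def contractPieces (U : X.Opens) (B : E.over U ⟶ (sheafHom (dual E) G).over U) (x : U) :
    Γ(G, piece hE U x) :=
  frameContract G (pieceFrame hE x) (restrictHom (Opens.infLELeft U (trivNbhd hE x.1)) B)

/-- The local pieces are compatible on overlaps (frame independence of `frameContract`).
[folklore] -/
lemma contractPieces_compatible (U : X.Opens) (B : E.over U ⟶ (sheafHom (dual E) G).over U)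
    (x y : U) :
    G.presheaf.map (Opens.infLELeft (piece hE U x) (piece hE U y)).op (contractPieces hE G U B x) =
      G.presheaf.map (Opens.infLERight (piece hE U x) (piece hE U y)).op
        (contractPieces hE G U B y) := by
  rw [contractPieces, contractPieces,
    map_frameContract_restrictHom G (pieceFrame hE x)
      (SheafOfModules.restrictTrivialisation (R := X.ringCatSheaf)
        (Opens.infLELeft (piece hE U x) (piece hE U y)) (pieceFrame hE x)),
    map_frameContract_restrictHom G (pieceFrame hE y)
      (SheafOfModules.restrictTrivialisation (R := X.ringCatSheaf)
        (Opens.infLELeft (piece hE U x) (piece hE U y)) (pieceFrame hE x)),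
    Subsingleton.elim (Opens.infLELeft _ _ ≫ Opens.infLELeft U (trivNbhd hE x.1))
      (Opens.infLERight _ _ ≫ Opens.infLELeft U (trivNbhd hE y.1))]

/-- **Existence and uniqueness of the contraction value** (`E` finite locally free): the unique
section of `G` over `U` restricting to the local pieces on the framed cover (sheaf property of `G`).
[folklore] -/
theorem existsUnique_contractValue (U : X.Opens) (B : E.over U ⟶ (sheafHom (dual E) G).over U) :
    ∃! t : Γ(G, U), ∀ x : U,
      G.presheaf.map (Opens.infLELeft U (trivNbhd hE x.1)).op t = contractPieces hE G U B x :=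
  TopCat.Sheaf.existsUnique_gluing' ((SheafOfModules.toSheaf _).obj G) (piece hE U) U
    (fun x => Opens.infLELeft U (trivNbhd hE x.1)) (le_iSup_piece hE) (contractPieces hE G U B)
    (fun x y => contractPieces_compatible hE G U B x y)

/-- **The contraction value** of `B ∈ Γ(𝓗om(E, 𝓗om(E^∨, G)), U)` in `Γ(G, U)` (glued from the
local sums `∑_i B(b_i)(λ_i)`). [folklore] -/
def contractValue (U : X.Opens) (B : E.over U ⟶ (sheafHom (dual E) G).over U) : Γ(G, U) :=
  (existsUnique_contractValue hE G U B).exists.choose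

/-- The contraction value restricts to the local pieces. [folklore] -/
lemma map_contractValue_piece (U : X.Opens) (B : E.over U ⟶ (sheafHom (dual E) G).over U) (x : U) :
    G.presheaf.map (Opens.infLELeft U (trivNbhd hE x.1)).op (contractValue hE G U B) =
      contractPieces hE G U B x :=
  (existsUnique_contractValue hE G U B).exists.choose_spec x

/-- **On a framed open the contraction value is `∑_i B(b_i)(λ_i)`**, for EVERY frame `e` of `E|_W`,
`W ≤ U` (compare the two sections of `G` over `W` on the cover `W ∩ U_x`). [folklore] -/
theorem map_contractValue {I : Type u} [Fintype I] (e : SheafOfModules.free I ≅ E.over W)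
    (k : W ⟶ U) (B : E.over U ⟶ (sheafHom (dual E) G).over U) :
    G.presheaf.map k.op (contractValue hE G U B) = frameContract G e (restrictHom k B) := by
  refine TopCat.Sheaf.eq_of_locally_eq' ((SheafOfModules.toSheaf _).obj G)
    (fun x : U => W ⊓ trivNbhd hE x.1) W (fun x => Opens.infLELeft _ _) ?_ _ _ fun x => ?_
  · intro y hy
    exact Opens.mem_iSup.2 ⟨⟨y, k.le hy⟩, hy, mem_trivNbhd hE y⟩
  · change G.presheaf.map (Opens.infLELeft W (trivNbhd hE x.1)).op
        (G.presheaf.map k.op (contractValue hE G U B)) =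
      G.presheaf.map (Opens.infLELeft W (trivNbhd hE x.1)).op (frameContract G e (restrictHom k B))
    have hle : W ⊓ trivNbhd hE x.1 ≤ piece hE U x := inf_le_inf_right _ k.le
    rw [presheaf_map_map,
      Subsingleton.elim (Opens.infLELeft W (trivNbhd hE x.1) ≫ k)
        (homOfLE hle ≫ Opens.infLELeft U (trivNbhd hE x.1)),
      ← presheaf_map_map, map_contractValue_piece, contractPieces,
      map_frameContract_restrictHom G (pieceFrame hE x)
        (SheafOfModules.restrictTrivialisation (R := X.ringCatSheaf)
          (Opens.infLELeft W (trivNbhd hE x.1)) e),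
      map_frameContract_restrictHom G e
        (SheafOfModules.restrictTrivialisation (R := X.ringCatSheaf)
          (Opens.infLELeft W (trivNbhd hE x.1)) e),
      Subsingleton.elim (homOfLE hle ≫ Opens.infLELeft U (trivNbhd hE x.1))
        (Opens.infLELeft W (trivNbhd hE x.1) ≫ k)]

/-- A section of `G` over `U` with the right restrictions to the framed cover is the contraction
value. [folklore] -/
lemma eq_contractValue (U : X.Opens) (B : E.over U ⟶ (sheafHom (dual E) G).over U) {t : Γ(G, U)}
    (ht : ∀ x : U, G.presheaf.map (Opens.infLELeft U (trivNbhd hE x.1)).op t =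
      contractPieces hE G U B x) : t = contractValue hE G U B :=
  (existsUnique_contractValue hE G U B).unique ht (map_contractValue_piece hE G U B)

/-- The contraction value is compatible with restriction. [folklore] -/
lemma map_contractValue_eq (l : V ⟶ U) (B : E.over U ⟶ (sheafHom (dual E) G).over U) :
    G.presheaf.map l.op (contractValue hE G U B) = contractValue hE G V (restrictHom l B) := by
  refine eq_contractValue hE G V (restrictHom l B) fun x => ?_
  rw [presheaf_map_map, map_contractValue hE G (pieceFrame hE x), contractPieces, ← restrictHom_comp']

/-- The contraction value is additive in `B`. [folklore] -/
lemma contractValue_add (U : X.Opens) (B B' : E.over U ⟶ (sheafHom (dual E) G).over U) :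
    contractValue hE G U (B + B') = contractValue hE G U B + contractValue hE G U B' := by
  symm
  refine eq_contractValue hE G U (B + B') fun x => ?_
  rw [map_add, map_contractValue_piece, map_contractValue_piece, contractPieces, contractPieces,
    contractPieces, restrictHom_add, frameContract_add]

/-- The contraction value is `𝒪_X(U)`-linear in `B`. [folklore] -/
lemma contractValue_smul (U : X.Opens) (a : Γ(X, U)) (B : E.over U ⟶ (sheafHom (dual E) G).over U) :
    contractValue hE G U (a • B) = a • contractValue hE G U B := by
  symm
  refine eq_contractValue hE G U (a • B) fun x => ?_
  rw [Scheme.Modules.map_smul, map_contractValue_piece, contractPieces, contractPieces,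
    restrictHom_smul, frameContract_smul]

/-- The contraction value of `0` is `0`. [folklore] -/
lemma contractValue_zero (U : X.Opens) :
    contractValue hE G U (0 : E.over U ⟶ (sheafHom (dual E) G).over U) = 0 := by
  have h := contractValue_add hE G U 0 0
  rw [add_zero] at h
  exact (left_eq_add.mp h).symm ▸ rfl

end ContractValue

/-! ### The contraction morphism and the trace -/

section Contract

variable {E : X.Modules} (hE : IsFiniteLocallyFree E) (G : X.Modules) {U V W : X.Opens}

/-- **The contraction `𝓗om(E, 𝓗om(E^∨, G)) → G`** of a finite locally free `E` (the evaluation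
`E^∨ ⊗ E ⊗ G → G`, `λ ⊗ s ⊗ g ↦ λ(s) g`, through `𝓗om(E, 𝓗om(E^∨, G)) ≅ E^∨ ⊗ E ⊗ G`,
Hartshorne II Ex. 5.1 (b)); sectionwise `contractValue`. [cite: Hartshorne1977, II Ex. 5.1 (b)] -/
def contract : sheafHom E (sheafHom (dual E) G) ⟶ G where
  val := PresheafOfModules.homMk
    { app := fun U => AddCommGrpCat.ofHom
        { toFun := fun B : E.over U.unop ⟶ (sheafHom (dual E) G).over U.unop =>
            (contractValue hE G U.unop B : Γ(G, U.unop))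
          map_zero' := contractValue_zero hE G U.unop
          map_add' := contractValue_add hE G U.unop }
      naturality := fun {U V} l => by
        refine AddCommGrpCat.ext fun (B : E.over U.unop ⟶ (sheafHom (dual E) G).over U.unop) => ?_
        exact (map_contractValue_eq hE G l.unop B).symm }
    (fun U (a : Γ(X, U.unop)) (B : E.over U.unop ⟶ (sheafHom (dual E) G).over U.unop) =>
      contractValue_smul hE G U.unop a B)

/-- Sections of the contraction: `B ↦ contractValue B`. [folklore] -/
@[simp]
lemma contract_app_apply (U : X.Opens) (B : E.over U ⟶ (sheafHom (dual E) G).over U) :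
    (contract hE G).app U B = contractValue hE G U B := rfl

/-- **Sections of the contraction in a frame**: `B ↦ ∑_i B(b_i)(λ_i)`. [folklore] -/
theorem contract_app_eq_frameContract {I : Type u} [Fintype I]
    (e : SheafOfModules.free I ≅ E.over W) (B : E.over W ⟶ (sheafHom (dual E) G).over W) :
    (contract hE G).app W B = frameContract G e B := by
  have h := map_contractValue hE G e (𝟙 W) B
  rwa [presheaf_map_id, restrictHom_id'] at h

/-- `𝓔nd(E) = 𝓗om(E, E) → 𝓗om(E, 𝓗om(E^∨, 𝒪_X)) = 𝓗om(E, E^∨∨)`: post-composition with the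
biduality map `E → E^∨∨`. [cite: Hartshorne1977, II Ex. 5.1 (a)] -/
def endToBidual : sheafHom E E ⟶ sheafHom E (sheafHom (dual E) (unitModule X)) :=
  sheafHomMap E (toBidual E (unitModule X))

/-- Sections of `endToBidual`: `φ ↦ φ ≫ (E → E^∨∨)|_U`. [folklore] -/
@[simp]
lemma endToBidual_app_apply (U : X.Opens) (φ : E.over U ⟶ E.over U) :
    (endToBidual (E := E)).app U φ =
      φ ≫ (SheafOfModules.overFunctor _ U).map (toBidual E (unitModule X)) := rfl

/-- **The trace `tr : 𝓔nd(E) = 𝓗om(E, E) → 𝒪_X`** of a finite locally free `𝒪_X`-module: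
`𝓗om(E, E) → 𝓗om(E, E^∨∨) → 𝒪_X`, biduality followed by the contraction; locally the trace of a
matrix (`trace_app_eq_sum`). The sheaf-level trace behind Illusie's / Buchweitz–Flenner's
`Tr : Extⁱ(F, F ⊗ G) → Hⁱ(X, G)`. [cite: Hartshorne1977, II Ex. 5.1 (a), (b)]
[cite: BuchweitzFlenner2003, §4 (trace map)] -/
def trace : sheafHom E E ⟶ unitModule X :=
  endToBidual ≫ contract hE (unitModule X)

/-- **The trace in a frame**: `tr(φ) = ∑_i λ_i(φ(b_i))` for `φ : E|_W → E|_W` and a frame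
`e : 𝒪^I ≅ E|_W` with basis `b_i`, dual basis `λ_i`. [folklore] -/
theorem trace_app_eq_sum {I : Type u} [Fintype I] (e : SheafOfModules.free I ≅ E.over W)
    (φ : E.over W ⟶ E.over W) :
    (trace hE).app W φ = ∑ i, appLE (dualBasis e i) (𝟙 W) (appLE φ (𝟙 W) (basisSection e i)) := by
  change (contract hE (unitModule X)).app W ((endToBidual (E := E)).app W φ) = _
  rw [contract_app_eq_frameContract hE _ e, endToBidual_app_apply]
  unfold frameContract
  refine Finset.sum_congr rfl fun i _ => ?_
  rw [appLE_comp_over_map, toBidual_app_apply]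
  change appLE (evalAt (M := unitModule X) (appLE φ (𝟙 W) (basisSection e i))) (𝟙 W)
    ((dualBasis e i : E.over W ⟶ (unitModule X).over W) : Γ(dual E, W)) = _
  rw [appLE_evalAt, presheaf_map_id]

/-- **`tr(a · id_E) = rk(E) · a`** on an open `W` where `E|_W ≅ 𝒪^I`. [folklore] -/
theorem trace_app_overScalar {I : Type u} [Fintype I] (e : SheafOfModules.free I ≅ E.over W)
    (a : Γ(X, W)) :
    (trace hE).app W (overScalar E W a) = (Fintype.card I : Γ(X, W)) * a := by
  classical
  rw [trace_app_eq_sum hE e]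
  have h : ∀ i, appLE (dualBasis e i) (𝟙 W) (appLE (overScalar E W a) (𝟙 W) (basisSection e i)) =
      (a : Γ(unitModule X, W)) := by
    intro i
    rw [appLE_overScalar, structurePresheaf_map_id, appLE_smul_right, ← coord_def,
      coord_basisSection, if_pos rfl]
    exact mul_one a
  simp_rw [h, Finset.sum_const, Finset.card_univ]
  exact nsmul_eq_mul _ a

/-- **`tr(id_E) = rk(E)`** on a framed open. [folklore] -/
theorem trace_app_id {I : Type u} [Fintype I] (e : SheafOfModules.free I ≅ E.over W) :
    (trace hE).app W (𝟙 (E.over W)) = (Fintype.card I : Γ(X, W)) := by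
  have h := trace_app_overScalar hE e 1
  rw [overScalar_one, mul_one] at h
  exact h

end Contract

end Literature.AlgebraicGeometry.Modules

end
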